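import Summits.Ventures.PercRepro.RankLevelSetHallCapLym

/-!
# PercRepro — THE CAPPED-LYM KERNEL, PART 2: THE ARITHMETIC `m̂`, `G`, `CapIneq`, THE `Y`-SETS `Z ∪ Y' ∪ U` AND THE CAP-COUNT
BOUND (p4, gen 38; paper proofs/P4-CAP-KERNEL.md §3)

For a member `Z` with `F = cl Z`, `D = F ∖ Z` (`d = #D`), `O = E ∖ F` (`ω = #O = p − d`): for `Y' ⊆ D` (`#Y' = j`) and `U ⊆ O`
with `1 ≤ #U = i ≤ k − 1`, the set `Z ∪ Y' ∪ U` is a `Y`-set (rank between `q + 1` and `q + i < p`), its cap count is at most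
`m̂(q, d, j, i) = Σ_{a ≤ min(q−d, i)} C(i, a) C(q + j, q − a)` (`capCount_union_le`: a `q`-subset `T` of it with `≤ q − d` elements
outside `cl Z` is determined by `(T ∩ U, T ∖ U)`), and distinct pairs give distinct sets.  Summing the weights over the
`C(d, j) C(ω, i)` pairs gives **`capG_le_capWeight_recv`**: every member receives at least
`G(q, k, d) = Σ_{i=1}^{k−1} C(q + k − d, i) Σ_{j ≤ d} C(d, j)/m̂(q, d, j, i)`.  With `CapIneq q k := ∀ d ≤ q, Φ(q+k, q) ≤ G(q, k, d)`
(a statement about binomial coefficients only — it holds for `q ≤ 71` (exact evaluation, `k ≤ 40`), for `d ≤ 1`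
and for `k = 2`, and it FAILS from `q = 72` (P4-CAP-KERNEL Addendum 2), so the reduction is sharp only for small `q`) this yields **`hallUp_of_ncard_eq_of_capIneq`**: `CapIneq q (p − q)` implies the
UP-Hall form of C-044 at the tight layer `#E = p + q` for every family of members.

* `capMhat`, `capG`, `CapIneq`;
* `capCount_union_le` — the cap count of `Z ∪ Y' ∪ U` is at most `m̂(q, d, #Y', #U)`;
* `mem_cellY_union`, `union_sdiff_closure`, `union_inter_closure` — the sets `Z ∪ Y' ∪ U` are `Y`-sets, with `U` and `Y'` recoverable;
The receipt bound `capG_le_capWeight_recv` and the final theorem `hallUp_of_ncard_eq_of_capIneq` are in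
`RankLevelSetHallCapLymReceipt`.
Axioms: standard.
-/

namespace PercRepro

open Set Matroid Finset

/-- `m̂(q, d, j, i) = Σ_{a ≤ min(q − d, i)} C(i, a) · C(q + j, q − a)`. -/
def capMhat (q d j i : ℕ) : ℕ :=
  ∑ a ∈ Finset.range (min (q - d) i + 1), i.choose a * (q + j).choose (q - a)

/-- `G(q, k, d) = Σ_{i=1}^{k−1} C(q + k − d, i) · Σ_{j ≤ d} C(d, j) / m̂(q, d, j, i)`. -/
noncomputable def capG (q k d : ℕ) : ℚ :=
  ∑ i ∈ Finset.Ico 1 k, (((q + k - d).choose i : ℕ) : ℚ) *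
    ∑ j ∈ Finset.range (d + 1), ((d.choose j : ℕ) : ℚ) / ((capMhat q d j i : ℕ) : ℚ)

/-- **The capped-LYM inequality** (a `Prop`): `Φ(q + k, q) ≤ G(q, k, d)` for every `0 ≤ d ≤ q`. -/
def CapIneq (q k : ℕ) : Prop := ∀ d ≤ q, phiK (q + k) q ≤ capG q k d

/-- `m̂ ≥ 1` (the `a = 0` term is `C(q + j, q) ≥ 1`). -/
theorem one_le_capMhat (q d j i : ℕ) : 1 ≤ capMhat q d j i := by
  unfold capMhat
  have h0 : 0 ∈ Finset.range (min (q - d) i + 1) := by rw [Finset.mem_range]; omega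
  calc 1 ≤ i.choose 0 * (q + j).choose (q - 0) := by
        rw [Nat.choose_zero_right, Nat.sub_zero, one_mul]
        exact Nat.choose_pos (by omega)
    _ ≤ ∑ a ∈ Finset.range (min (q - d) i + 1), i.choose a * (q + j).choose (q - a) :=
        Finset.single_le_sum (f := fun a => i.choose a * (q + j).choose (q - a)) (fun _ _ => Nat.zero_le _) h0

variable {α : Type} (M : Matroid α) [M.Finite]

omit [M.Finite] in
/-- `(Z ∪ Y' ∪ U) ∖ cl Z = U` for `Y' ⊆ cl Z`, `U ∩ cl Z = ∅`. -/
theorem union_sdiff_closure (Z Y' U : Set α) (hZE : Z ⊆ M.E) (hY' : Y' ⊆ M.closure Z) (hU : Disjoint U (M.closure Z)) :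
    (Z ∪ Y' ∪ U) \ M.closure Z = U := by
  have hZcl : Z ⊆ M.closure Z := M.subset_closure Z hZE
  ext x
  simp only [Set.mem_sdiff, Set.mem_union]
  constructor
  · rintro ⟨(h | h) | h, hx⟩
    · exact absurd (hZcl h) hx
    · exact absurd (hY' h) hx
    · exact h
  · intro h
    exact ⟨Or.inr h, fun hx => Set.disjoint_left.1 hU h hx⟩

omit [M.Finite] in
/-- `(Z ∪ Y' ∪ U) ∩ cl Z = Z ∪ Y'` for `Y' ⊆ cl Z`, `U ∩ cl Z = ∅`. -/
theorem union_inter_closure (Z Y' U : Set α) (hZE : Z ⊆ M.E) (hY' : Y' ⊆ M.closure Z) (hU : Disjoint U (M.closure Z)) :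
    (Z ∪ Y' ∪ U) ∩ M.closure Z = Z ∪ Y' := by
  have hZcl : Z ⊆ M.closure Z := M.subset_closure Z hZE
  ext x
  simp only [Set.mem_inter_iff, Set.mem_union]
  constructor
  · rintro ⟨(h | h) | h, hx⟩
    · exact Or.inl h
    · exact Or.inr h
    · exact absurd hx (Set.disjoint_left.1 hU h)
  · rintro (h | h)
    · exact ⟨Or.inl (Or.inl h), hZcl h⟩
    · exact ⟨Or.inl (Or.inr h), hY' h⟩

omit [M.Finite] in
/-- `Z ∪ Y' ∪ U` is a `Y`-set of the cell `(p, q)` when `Z` is a member, `Y' ⊆ cl Z ∖ Z`, `U ⊆ E ∖ cl Z` with `1 ≤ #U ≤ p − q − 1`. -/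
theorem mem_cellY_union (p q : ℕ) {Z Y' U : Set α} (hZ : Z ∈ cellMembers M p q) (hY' : Y' ⊆ M.closure Z \ Z)
    (hU : U ⊆ M.E \ M.closure Z) (hUfin : U.Finite) (hU1 : 1 ≤ U.ncard) (hUk : U.ncard + q < p) :
    Z ∪ Y' ∪ U ∈ cellY M p q := by
  have hZE : Z ⊆ M.E := hZ.1
  have hZq : M.eRk Z = (q : ℕ∞) := hZ.2.1
  have hY'cl : Y' ⊆ M.closure Z := hY'.trans sdiff_subset
  have hUE : U ⊆ M.E := hU.trans sdiff_subset
  have hUcl : Disjoint U (M.closure Z) := by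
    rw [Set.disjoint_left]
    intro x hx hxcl
    exact (hU hx).2 hxcl
  -- rank ≤ q + #U
  have hupper : M.eRk (Z ∪ Y' ∪ U) ≤ (q : ℕ∞) + (U.ncard : ℕ∞) := by
    have h1 : M.eRk (Z ∪ Y') = (q : ℕ∞) := by
      apply le_antisymm
      · calc M.eRk (Z ∪ Y') ≤ M.eRk (M.closure Z) :=
              M.eRk_mono (Set.union_subset (M.subset_closure Z hZE) hY'cl)
          _ = (q : ℕ∞) := by rw [M.eRk_closure_eq, hZq]
      · rw [← hZq]
        exact M.eRk_mono Set.subset_union_left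
    calc M.eRk (Z ∪ Y' ∪ U) ≤ M.eRk (Z ∪ Y') + M.eRk U := M.eRk_union_le_eRk_add_eRk _ _
      _ ≤ (q : ℕ∞) + U.encard := by
          rw [h1]
          exact add_le_add_right (M.eRk_le_encard U) _
      _ = (q : ℕ∞) + (U.ncard : ℕ∞) := by rw [hUfin.cast_ncard_eq]
  -- rank ≥ q + 1: an element of U is outside cl Z
  have hlower : (q : ℕ∞) + 1 ≤ M.eRk (Z ∪ Y' ∪ U) := by
    obtain ⟨o, ho⟩ : U.Nonempty := by
      rw [← Set.ncard_pos hUfin]; omega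
    have hoZ : o ∈ M.E \ M.closure Z := hU ho
    have h2 : M.eRk (insert o Z) = M.eRk Z + 1 := M.eRk_insert_eq_add_one hoZ
    calc (q : ℕ∞) + 1 = M.eRk (insert o Z) := by rw [h2, hZq]
      _ ≤ M.eRk (Z ∪ Y' ∪ U) := by
          apply M.eRk_mono
          intro x hx
          rcases Set.mem_insert_iff.1 hx with h | h
          · rw [h]; exact Or.inr ho
          · exact Or.inl (Or.inl h)
  refine ⟨Set.union_subset (Set.union_subset hZE (hY'cl.trans (M.closure_subset_ground Z))) hUE, ?_, ?_⟩
  · calc (q : ℕ∞) < (q : ℕ∞) + 1 := by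
          exact_mod_cast (show q < q + 1 by omega)
      _ ≤ M.eRk (Z ∪ Y' ∪ U) := hlower
  · calc M.eRk (Z ∪ Y' ∪ U) ≤ (q : ℕ∞) + (U.ncard : ℕ∞) := hupper
      _ < (p : ℕ∞) := by
          have : ((q + U.ncard : ℕ) : ℕ∞) < (p : ℕ∞) := by exact_mod_cast (show q + U.ncard < p by omega)
          push_cast at this
          exact this

/-- **The cap count of `Z ∪ Y' ∪ U` is at most `m̂(q, d, #Y', #U)`**: a `q`-subset `T` with `#(T ∖ cl Z) ≤ q − d` is determined
by the pair `(T ∩ U, T ∖ U)`, `T ∩ U` an `a`-subset of `U` with `a ≤ min(q − d, #U)` and `T ∖ U` a `(q − a)`-subset of `Z ∪ Y'`. -/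
theorem capCount_union_le (q : ℕ) {Z Y' U : Set α} (hZE : Z ⊆ M.E) (hZq : Z.ncard = q) (hY' : Y' ⊆ M.closure Z \ Z)
    (hU : U ⊆ M.E \ M.closure Z) :
    capCount M q Z (Z ∪ Y' ∪ U) ≤ capMhat q (M.closure Z \ Z).ncard Y'.ncard U.ncard := by
  classical
  set d : ℕ := (M.closure Z \ Z).ncard with hd
  have hEfin : M.E.Finite := M.set_finite M.E
  have hZfin : Z.Finite := hEfin.subset hZE
  have hY'fin : Y'.Finite := (hEfin.subset (M.closure_subset_ground Z)).subset (hY'.trans sdiff_subset)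
  have hUfin : U.Finite := hEfin.subset (hU.trans sdiff_subset)
  have hY'cl : Y' ⊆ M.closure Z := hY'.trans sdiff_subset
  have hUcl : Disjoint U (M.closure Z) := by
    rw [Set.disjoint_left]
    intro x hx hxcl
    exact (hU hx).2 hxcl
  set Zf : Finset α := hZfin.toFinset with hZf
  set Yf : Finset α := hY'fin.toFinset with hYf
  set Uf : Finset α := hUfin.toFinset with hUf
  have hZfc : Zf.card = q := by rw [hZf, ← ncard_eq_toFinset_card _ hZfin, hZq]
  have hYfc : Yf.card = Y'.ncard := by rw [hYf, ← ncard_eq_toFinset_card _ hY'fin]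
  have hUfc : Uf.card = U.ncard := by rw [hUf, ← ncard_eq_toFinset_card _ hUfin]
  have hZY : Disjoint Zf Yf := by
    rw [Finset.disjoint_left]
    intro x hx hy
    rw [hZf, hZfin.mem_toFinset] at hx
    rw [hYf, hY'fin.mem_toFinset] at hy
    exact (hY' hy).2 hx
  have hZYc : (Zf ∪ Yf).card = q + Y'.ncard := by rw [Finset.card_union_of_disjoint hZY, hZfc, hYfc]
  -- the index finset and the map
  set B : Finset (Finset α × Finset α) := (Finset.range (min (q - d) U.ncard + 1)).biUnion
    (fun a => Uf.powersetCard a ×ˢ (Zf ∪ Yf).powersetCard (q - a)) with hB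
  let g : Finset α × Finset α → Set α := fun pr => (pr.1 : Set α) ∪ (pr.2 : Set α)
  -- the cap set lies in the image
  have hsub : capSet M q Z (Z ∪ Y' ∪ U) ⊆ ((B.image g : Finset (Set α)) : Set (Set α)) := by
    intro T hT
    obtain ⟨hTS, hTq, hTcap⟩ := hT
    have hSfin : (Z ∪ Y' ∪ U).Finite := (hZfin.union hY'fin).union hUfin
    have hTfin : T.Finite := hSfin.subset hTS
    set Tf : Finset α := hTfin.toFinset with hTf
    have hmemT : ∀ x, x ∈ Tf ↔ x ∈ T := fun x => by rw [hTf, hTfin.mem_toFinset]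
    have hmemU : ∀ x, x ∈ Uf ↔ x ∈ U := fun x => by rw [hUf, hUfin.mem_toFinset]
    have hmemZ : ∀ x, x ∈ Zf ↔ x ∈ Z := fun x => by rw [hZf, hZfin.mem_toFinset]
    have hmemY : ∀ x, x ∈ Yf ↔ x ∈ Y' := fun x => by rw [hYf, hY'fin.mem_toFinset]
    -- T ∖ cl Z = T ∩ U
    have hTU : T \ M.closure Z = T ∩ U := by
      ext x
      simp only [Set.mem_sdiff, Set.mem_inter_iff]
      constructor
      · rintro ⟨hxT, hxcl⟩
        refine ⟨hxT, ?_⟩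
        rcases hTS hxT with (h | h) | h
        · exact absurd (M.subset_closure Z hZE h) hxcl
        · exact absurd (hY'cl h) hxcl
        · exact h
      · rintro ⟨hxT, hxU⟩
        exact ⟨hxT, Set.disjoint_left.1 hUcl hxU⟩
    set A : Finset α := Tf ∩ Uf with hA
    set Bf : Finset α := Tf \ Uf with hBf
    have hAcoe : (A : Set α) = T ∩ U := by
      ext x
      simp only [hA, Finset.coe_inter, Set.mem_inter_iff, Finset.mem_coe, hmemT, hmemU]
    have hBcoe : (Bf : Set α) = T \ U := by
      ext x
      simp only [hBf, Finset.coe_sdiff, Set.mem_sdiff, Finset.mem_coe, hmemT, hmemU]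
    have hAcard : A.card = (T ∩ U).ncard := by rw [← ncard_coe_finset, hAcoe]
    have hAle : A.card ≤ q - d := by rw [hAcard, ← hTU]; exact hTcap
    have hAleU : A.card ≤ U.ncard := by
      rw [hAcard]
      exact Set.ncard_le_ncard Set.inter_subset_right hUfin
    have hTcard : Tf.card = q := by rw [hTf, ← ncard_eq_toFinset_card _ hTfin, hTq]
    have hBcard : Bf.card = q - A.card := by
      rw [hBf, Finset.card_sdiff, ← hTcard, hA, Finset.inter_comm]
    rw [Finset.mem_coe, Finset.mem_image]
    refine ⟨(A, Bf), ?_, ?_⟩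
    · rw [hB, Finset.mem_biUnion]
      refine ⟨A.card, ?_, ?_⟩
      · rw [Finset.mem_range]
        omega
      · rw [Finset.mem_product]
        refine ⟨?_, ?_⟩
        · rw [Finset.mem_powersetCard]
          exact ⟨Finset.inter_subset_right, rfl⟩
        · rw [Finset.mem_powersetCard]
          refine ⟨?_, hBcard⟩
          intro x hx
          rw [hBf, Finset.mem_sdiff, hmemT, hmemU] at hx
          rw [Finset.mem_union, hmemZ, hmemY]
          rcases hTS hx.1 with (h | h) | h
          · exact Or.inl h
          · exact Or.inr h
          · exact absurd h hx.2
    · show (A : Set α) ∪ (Bf : Set α) = T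
      rw [hAcoe, hBcoe]
      ext x
      simp only [Set.mem_union, Set.mem_inter_iff, Set.mem_sdiff]
      constructor
      · rintro (⟨h, -⟩ | ⟨h, -⟩) <;> exact h
      · intro h
        by_cases hxU : x ∈ U
        · exact Or.inl ⟨h, hxU⟩
        · exact Or.inr ⟨h, hxU⟩
  -- count
  have hcount : (B.image g).card ≤ capMhat q d Y'.ncard U.ncard := by
    calc (B.image g).card ≤ B.card := Finset.card_image_le
      _ ≤ ∑ a ∈ Finset.range (min (q - d) U.ncard + 1), (Uf.powersetCard a ×ˢ (Zf ∪ Yf).powersetCard (q - a)).card :=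
          Finset.card_biUnion_le
      _ = capMhat q d Y'.ncard U.ncard := by
          unfold capMhat
          apply Finset.sum_congr rfl
          intro a _
          rw [Finset.card_product, Finset.card_powersetCard, Finset.card_powersetCard, hUfc, hZYc]
  unfold capCount
  calc (capSet M q Z (Z ∪ Y' ∪ U)).ncard ≤ ((B.image g : Finset (Set α)) : Set (Set α)).ncard :=
        Set.ncard_le_ncard hsub (Finset.finite_toSet _)
    _ = (B.image g).card := ncard_coe_finset _
    _ ≤ capMhat q d Y'.ncard U.ncard := hcount

end PercRepro
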